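import Mathlib.Topology.Order.IntermediateValue
import Literature.MathematicalPhysics.StatisticalMechanics.DiluteHardSphereGas
import Summits.AtomisticToContinuum.HydrodynamicLimit.Theorems.AntiMazurCoboundariesCorrectorPressureDecayKiferTangentEntropyDebt

/-!
# The dilute Gibbs reference state of prescribed density (`DiluteGibbsState`, fact F1 of line `FirstLemma`)
# from the low-activity hard-sphere gas — crux stmt-AtomisticToContinuum-14135 `AntiMazurCoboundaries.CorrectorPressureDecay`

`DiluteGibbsState` (`…KiferTangentEntropyDebt.lean`) asks, below a density threshold `σ₁`, for a
translation-invariant unit-diameter hard-sphere Gibbs state (DLR, `IsHardSphereGibbs 1 z θ⁻¹ u₀ G`) of density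
EXACTLY `σ³` and activity `0 < z ≤ 2σ³`. The tree has no construction of infinite-volume Gibbs states
(`HardSphereGibbsState.lean`: "Deliberately NOT here"; `HardSphereKirkwoodSalsburg.lean`: correlation FUNCTIONS
only; the route item `Theses.RelEntropyErgodic.LowActivityGibbsState` is unproved), so this file performs the
honest REDUCTION of `DiluteGibbsState` to ONE published fact plus the intermediate value theorem:

* the named fact `Literature.MathematicalPhysics.StatisticalMechanics.RuelleDiluteHardSphereGas`
  (`Literature/MathematicalPhysics/StatisticalMechanics/DiluteHardSphereGas.lean`; Ruelle 1969 Thm 4.2.3 /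
  Thm 4.3.1 with (3.12), Dobrushin–Sinai–Sukhov Chap. 10 §2.4–2.5): a density function `ρ`, continuous on
  `(0, z₁)` with `z - C z² ≤ ρ(z) ≤ z`, and for every `0 < z < z₁`, `β > 0`, `u` a translation-invariant DLR
  state of activity `z` and density `ρ(z)`;
* `stub_diluteGibbsStateOfFact : RuelleDiluteHardSphereGas → DiluteGibbsState` (REGISTERED stub): with
  `σ₁ := min 1 (min (z₁/4) (1/(4C+4)))` and `s := σ³ ≤ σ` one has `[s, 2s] ⊆ (0, z₁)`, `ρ(s) ≤ s` and
  `ρ(2s) ≥ 2s - 4Cs² ≥ s` (as `4Cs ≤ 1`), so `intermediate_value_Icc` gives `z ∈ [s, 2s]` with `ρ(z) = s`;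
  the Gibbs state at `(z, β = θ⁻¹, u = u₀)` is the witness (`0 < s ≤ z ≤ 2s = 2σ³`, density `ofReal (ρ z) =
  ofReal (σ³)`). No cube roots are needed.
-/

noncomputable section

open MeasureTheory Set Filter Topology

namespace Summit.AtomisticToContinuum.HydrodynamicLimit.Theorems.KiferCompactification

open Literature.MathematicalPhysics.StatisticalMechanics (RuelleDiluteHardSphereGas)

/-- **F1 FROM THE LOW-ACTIVITY GAS** (registered stub `stub_diluteGibbsStateOfFact` of line `FirstLemma`, crux
stmt-AtomisticToContinuum-14135): the dilute translation-invariant unit-diameter hard-sphere Gibbs state of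
PRESCRIBED density `σ³` and activity `0 < z ≤ 2σ³` (`DiluteGibbsState`) exists below the threshold
`σ₁ := min 1 (min (z₁/4) (1/(4C+4)))`, by the intermediate value theorem applied to the continuous density
`ρ` on `[σ³, 2σ³] ⊆ (0, z₁)`: `ρ(σ³) ≤ σ³ ≤ 2σ³ - C(2σ³)² ≤ ρ(2σ³)`. -/
theorem stub_diluteGibbsStateOfFact : RuelleDiluteHardSphereGas → DiluteGibbsState := by
  rintro ⟨z₁, C, hz₁, hC, ρ, hρ, hbd, hgas⟩
  refine ⟨min 1 (min (z₁ / 4) (1 / (4 * C + 4))), by positivity, ?_⟩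
  intro σ hσ hσlt θ hθ u₀
  -- the threshold: `σ ≤ 1`, `σ < z₁ / 4`, `σ < 1 / (4C + 4)`
  have hσ1 : σ ≤ 1 := hσlt.le.trans (min_le_left _ _)
  have hσz : σ < z₁ / 4 := hσlt.trans_le ((min_le_right _ _).trans (min_le_left _ _))
  have hσC : σ < 1 / (4 * C + 4) := hσlt.trans_le ((min_le_right _ _).trans (min_le_right _ _))
  -- `s := σ³` satisfies `0 < s ≤ σ`
  set s : ℝ := σ ^ 3 with hs_def
  have hs : 0 < s := by positivity
  have hsσ : s ≤ σ := by
    calc s = σ * (σ * σ) := by rw [hs_def]; ring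
      _ ≤ σ * (1 * 1) := by gcongr
      _ = σ := by ring
  have h2s : 2 * s < z₁ := by linarith
  have hCs : 4 * C * s ≤ 1 := by
    have h4 : 0 < 4 * C + 4 := by positivity
    have h1 : σ * (4 * C + 4) < 1 := by
      calc σ * (4 * C + 4) < 1 / (4 * C + 4) * (4 * C + 4) := by gcongr
        _ = 1 := by field_simp
    nlinarith
  -- the density at the two ends of `[s, 2s]`
  have hlow : ρ s ≤ s := (hbd s hs (by linarith)).2
  have hhigh : s ≤ ρ (2 * s) := by
    have h := (hbd (2 * s) (by positivity) h2s).1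
    nlinarith
  -- intermediate value theorem on `[s, 2s] ⊆ (0, z₁)`
  have hcont : ContinuousOn ρ (Icc s (2 * s)) :=
    hρ.mono fun z hz => ⟨hs.trans_le hz.1, hz.2.trans_lt h2s⟩
  obtain ⟨z, hz, hρz⟩ := intermediate_value_Icc (by linarith) hcont ⟨hlow, hhigh⟩
  have hz0 : 0 < z := hs.trans_le hz.1
  obtain ⟨G, hG, hGT, hGd⟩ := hgas θ⁻¹ (inv_pos.2 hθ) u₀ z hz0 (hz.2.trans_lt h2s)
  exact ⟨z, G, hz0, hz.2, hG, hGT, by rw [hGd, hρz]⟩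

end Summit.AtomisticToContinuum.HydrodynamicLimit.Theorems.KiferCompactification

end
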